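import Literature.MathematicalPhysics.QuantumFieldTheory.Balaban1983to89.B15Prop1DatumGaugeNormalisation
import Literature.MathematicalPhysics.QuantumFieldTheory.Balaban1983to89.B15DeterminingSetsB

/-!
# `Balaban1983to89.B15Prop1DatumGaugeNormalisationB` — [Balaban1988Convergent] = «[III]», (2.2) p. 255 («Γ₀ = Ω₁ᶜ»), (2.12)–(2.13) pp. 256–257, (2.16) p. 257;
# [Balaban1984PropagatorsII] = «[II]», (2.3) p. 224 (the BOND-level determining datum); [Balaban1989LargeFieldI] = «[IV]», p. 193, Prop. 1 p. 194:
# THE PINNED HALF OF THE LOCALISED NEAR-FLATNESS OVER A BOND DETERMINING SET `𝔅 : BDetSet P` — print-datum ([II] (2.3)) edition of the lane's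
# `B15Prop1DatumGaugeNormalisation` §9 (the one datum-typed declaration of that module which N12's junction of record v14ᴸ uses:
# `dist1_apply_le_of_isMinimizer_Bj_of_not_mem`) — class (γ)∕STRUCTURAL of dag-n12-c's census-by-declaration v2 (bus [DAGN12C-G35]∕[DAGN12C-G36], 2026-08-30)

Honest framing: statement-level skeleton of published theorems with citation tags; proofs where landed; nothing here is a claim about the
Yang–Mills mass gap.  Cell `pub-ymgap`, seat `pub-ymgap-dag-n12-c` (g36; LANE OWNER N12 = [B15], strategy s1); count-neutral helper of K1⁹ (`stmt-QuantumFields-27364`);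
N12 NOT discharged; finite 𝕋⁴ at fixed ε; nothing continuum ∕ OS ∕ mass-gap ∕ Clay.

WHY A SEPARATE EDITION, AND WHAT CHANGES (the (E1)(iii-b) re-attachment, director-ym №338–№358; LOCATED-2 of the lane's census).  The parent's §9 reads the STRUCTURE of the
tree's site-level determining set `𝐁_k(Z) = Bj M₁ Z k` once: its scale-`0` member is `Γ₀ = Ω₁(Z)ᶜ` as a SITE set, so `bondsOf Γ₀` = the fine bonds MEETING `Ω₁(Z)ᶜ` (`Bj_zero`:
`b₋ ∉ Ω₁ ∨ b₊ ∉ Ω₁`), and every such bond is pinned by the scale-`0` constraint `M⁰(U) = U = Q_k^{s*}W`.  Over print's [II] (2.3) BOND-level datum `𝔅` (`B15DeterminingSetsB.lamBondsSeq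
(maxDomT M₁ Z) k`; `mem_lamBondsSeq_iff_zero`) the scale-`0` member consists of the bonds with an end-point off `Ω₁` AND NO end-point whose `1`-block lies in `Ω₁^{(1)}` — for the block
union `Ω₁(Z)` exactly the bonds with BOTH end-points off `Ω₁(Z)` (`B15Prop1GradientFromNearValueB.mem_lamDatumP_maxDomT_zero_of_not_mem₂`); the CROSSING bonds (one end in `Ω₁(Z)`,
one end off) are free variables of (2.12) and are NOT pinned.  This edition therefore states the pinned half (i) DATUM-INTRINSICALLY, for `b ∈ 𝔅 0` (no `Ω₁` at all), and (ii) in the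
`Ω₁`-currency of the consumers through the displayed letter `h𝔅0 : ∀ b, b₋ ∉ Ω₁(Z) → b₊ ∉ Ω₁(Z) → b ∈ 𝔅 0` with BOTH end-points off `Ω₁(Z)` as hypotheses (`hbs`, `hbt`).
RE-KEY NOTE for the junction's generator (dag-n12-d): `dist1_apply_le_of_isMinimizer_Bj_of_not_mem … hk0 hk W hU hδ hb hW` with `hb : b₋ ∉ Ω₁ ∨ b₊ ∉ Ω₁` becomes
`dist1_apply_le_of_isMinimizerB_of_not_mem₂ … hk W 𝔅 h𝔅0 hU hδ hbs hbt hW` (`hk0` dropped — it served `Bj_zero` only; `hU : IsMinimizerB av reg 𝔅 …`); a consumer holding only the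
one-endpoint `∨` must split: both off ⇒ this file; one end in `Ω₁` ⇒ the bond is a crossing bond, covered by the INTERIOR letter of the tower-axial gauge (`B15Prop1GaugeLetterGammaZeroPinB`,
where `hL` is asked on the bonds TOUCHING `Ω₁(Z)`).  At print's datum: `h𝔅0 := fun b hs ht => mem_lamDatumP_maxDomT_zero_of_not_mem₂ hM hk0 hk hdiv b hs ht`.

CONTENTS (theorems only; no `def`, no `instance`, no `sorry`; namespace `…B15Prop1DatumGaugeNormalisationB`; any `GaugeGroup`).
§9ᴮ ★★ `dist1_apply_le_of_isMinimizerB_of_mem` (datum-intrinsic: `b ∈ 𝔅 0`), ★★ `dist1_apply_le_of_isMinimizerB_of_not_mem₂` (both end-points off `Ω₁(Z)`, via `h𝔅0`),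
`dist1_gaugeAct_apply_le_of_isMinimizerB_of_not_mem₂` (the residually gauged minimiser, `σ` trivial at both ends), ★★ `dist1_apply_le_of_isMinimizerB_of_shadow` (set form: the shadows of
the block-crossing bonds of a neighbourhood `𝒩` with both end-points off `Ω₁(Z)` lie in a normalised region `𝒞`), `dist1_apply_le_of_isMinimizerB_of_mem_of_shadow` (set form, datum-intrinsic).
HONEST SCOPE: kernel bookkeeping of [III] (2.2)∕(2.12)∕(2.16); the minimiser is a HYPOTHESIS ([15] Thm 1 ∕ the lane's (E)); nothing of Bałaban's estimates asserted; count-neutral;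
N12 NOT discharged; the YM mass gap (Clay) is NOT proved by any of this — R4 closes only the conditional finite-𝕋⁴ rung `BalabanLadder.UV`.
-/

noncomputable section

namespace Literature.MathematicalPhysics.QuantumFieldTheory.Balaban1983to89.B15Prop1DatumGaugeNormalisationB

open B15DeterminingSets B15DeterminingSetsB
open B14.Eq213DetSet (maxDomT)
open B14.Eq216Concrete (qsstarGIter0_eq)
open Literature.MathematicalPhysics.QuantumFieldTheory.BalabanImbrieJaffe1984to88.BIJ85Eq453GaugeField (qsstarGIter0)

variable {P : Params} {G : Type*} [GaugeGroup G]

/-! ## §9ᴮ  The PINNED half of the localised near-flatness over a bond determining set -/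

/-- ★★ **ON THE SCALE-`0` MEMBERS OF THE DATUM A (2.12) MINIMISER IS AS NEAR `1` AS THE DATUM FIELD'S SHADOW — DATUM-INTRINSIC FORM.**  OBJECTS: any averaging family `av`, any
class `reg`, a BOND determining set `𝔅` ([II] (2.3)), a height `k ≤ m + K`, a `k`-field `W` generating the data `M˙(Q_k^{s*}W)` ([III] (2.10)–(2.12)), a minimiser `U` (`IsMinimizerB`), and a
fine bond `b ∈ 𝔅 0`.  The scale-`0` constraint is `M⁰(U)(b) = U(b) = (Q_k^{s*}W)(b)`, which is `1` inside a `k`-block and the shadow value `W⟨B^k b₋, μ(b)⟩` on a block-crossing bond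
([III] (1.3)∕(2.16), `qsstarGIter0_eq`); so `dist1 (U b) ≤ δ` as soon as the shadow is `δ`-near `1` (asked only when `b` crosses; `0 ≤ δ`).
[cite: Balaban1988Convergent, (2.12)–(2.13) pp.256–257, (2.16) p.257; Balaban1984PropagatorsII, (2.3) p.224] -/
theorem dist1_apply_le_of_isMinimizerB_of_mem (av : ∀ j, Averaging P j G) (reg : Set (GaugeField P 0 G))
    {k : ℕ} (hk : k ≤ P.m + P.K) (W : GaugeField P k G) (𝔅 : BDetSet P) {U : GaugeField P 0 G}
    (hU : IsMinimizerB av reg 𝔅 (avgFamily av (qsstarGIter0 k W)) U) {δ : ℝ} (hδ : 0 ≤ δ)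
    {b : PBond P 0} (hb : b ∈ 𝔅 0)
    (hW : B14.Eq22Determines.blockIter k b.tgt ≠ B14.Eq22Determines.blockIter k b.src → dist1 (W ⟨B14.Eq22Determines.blockIter k b.src, b.dir⟩) ≤ δ) :
    dist1 (U b) ≤ δ := by
  have h1 : U b = qsstarGIter0 k W b := hU.2.1 0 b hb
  rw [h1, qsstarGIter0_eq k hk W b]
  split_ifs with h
  · rw [GaugeGroup.dist1_one]; exact hδ
  · exact hW h

/-- ★★ **ON THE BONDS WITH BOTH END-POINTS OFF `Ω₁(Z)` A (2.12) MINIMISER IS AS NEAR `1` AS THE DATUM'S SHADOW** — the `Ω₁`-currency form of the pinned half over a bond datum whose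
scale-`0` member contains every bond with both end-points off `Ω₁(Z) = maxDomT M₁ Z 1` (the letter `h𝔅0`; print's [II] (2.3) datum at `Z`'s maximal sequence has it, `Ω₁(Z)` being a union of
`1`-blocks: `B15Prop1GradientFromNearValueB.mem_lamDatumP_maxDomT_zero_of_not_mem₂`).  The parent's one-endpoint hypothesis `b₋ ∉ Ω₁ ∨ b₊ ∉ Ω₁` is NOT sufficient here: a crossing bond is
not a member of print's `Λ₀`. [cite: Balaban1988Convergent, (2.2) p.255, (2.12)–(2.13) pp.256–257, (2.16) p.257; Balaban1984PropagatorsII, (2.3) p.224] -/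
theorem dist1_apply_le_of_isMinimizerB_of_not_mem₂ (av : ∀ j, Averaging P j G) (reg : Set (GaugeField P 0 G)) (M₁ : ℕ)
    (Z : Set (Site P 0)) {k : ℕ} (hk : k ≤ P.m + P.K) (W : GaugeField P k G) (𝔅 : BDetSet P)
    (h𝔅0 : ∀ b : PBond P 0, b.src ∉ maxDomT M₁ Z 1 → b.tgt ∉ maxDomT M₁ Z 1 → b ∈ 𝔅 0)
    {U : GaugeField P 0 G} (hU : IsMinimizerB av reg 𝔅 (avgFamily av (qsstarGIter0 k W)) U) {δ : ℝ} (hδ : 0 ≤ δ)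
    {b : PBond P 0} (hbs : b.src ∉ maxDomT M₁ Z 1) (hbt : b.tgt ∉ maxDomT M₁ Z 1)
    (hW : B14.Eq22Determines.blockIter k b.tgt ≠ B14.Eq22Determines.blockIter k b.src → dist1 (W ⟨B14.Eq22Determines.blockIter k b.src, b.dir⟩) ≤ δ) :
    dist1 (U b) ≤ δ :=
  dist1_apply_le_of_isMinimizerB_of_mem av reg hk W 𝔅 hU hδ (h𝔅0 b hbs hbt) hW

/-- The same for the residually gauged minimiser `U^σ` when `σ` is trivial at both ends of the bond (the `j = 0` clause of the root letter `hu` of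
`B15Prop1GaugeRetractionOfGaugeSectionB.agreeOn_gaugeAct_of_residual`). [cite: Balaban1988Convergent, (2.2) p.255, (2.12) p.256; Balaban1984PropagatorsII, (2.3) p.224] -/
theorem dist1_gaugeAct_apply_le_of_isMinimizerB_of_not_mem₂ (av : ∀ j, Averaging P j G) (reg : Set (GaugeField P 0 G)) (M₁ : ℕ)
    (Z : Set (Site P 0)) {k : ℕ} (hk : k ≤ P.m + P.K) (W : GaugeField P k G) (𝔅 : BDetSet P)
    (h𝔅0 : ∀ b : PBond P 0, b.src ∉ maxDomT M₁ Z 1 → b.tgt ∉ maxDomT M₁ Z 1 → b ∈ 𝔅 0)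
    {U : GaugeField P 0 G} (hU : IsMinimizerB av reg 𝔅 (avgFamily av (qsstarGIter0 k W)) U) {δ : ℝ} (hδ : 0 ≤ δ)
    (σ : GaugeTransf P 0 G) {b : PBond P 0} (hσs : σ b.src = 1) (hσt : σ b.tgt = 1)
    (hbs : b.src ∉ maxDomT M₁ Z 1) (hbt : b.tgt ∉ maxDomT M₁ Z 1)
    (hW : B14.Eq22Determines.blockIter k b.tgt ≠ B14.Eq22Determines.blockIter k b.src → dist1 (W ⟨B14.Eq22Determines.blockIter k b.src, b.dir⟩) ≤ δ) :
    dist1 (GaugeField.gaugeAct σ U b) ≤ δ := by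
  rw [GaugeField.gaugeAct, hσs, hσt, one_mul, inv_one, mul_one]
  exact dist1_apply_le_of_isMinimizerB_of_not_mem₂ av reg M₁ Z hk W 𝔅 h𝔅0 hU hδ hbs hbt hW

/-- ★★ **WITH A SHADOW HYPOTHESIS AND A NORMALISED DATUM** (`Ω₁`-currency): if the datum field `W` is `δ`-near `1` on a set `𝒞` of `k`-bonds containing the shadow of every
block-crossing bond of the neighbourhood `𝒩` with BOTH end-points off `Ω₁(Z)`, then the minimiser is `δ`-near `1` on every such bond of `𝒩`.
[cite: Balaban1988Convergent, (2.2) p.255, (2.12)–(2.13) pp.256–257, (2.16) p.257; Balaban1984PropagatorsII, (2.3) p.224] -/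
theorem dist1_apply_le_of_isMinimizerB_of_shadow (av : ∀ j, Averaging P j G) (reg : Set (GaugeField P 0 G)) (M₁ : ℕ)
    (Z : Set (Site P 0)) {k : ℕ} (hk : k ≤ P.m + P.K) (W : GaugeField P k G) (𝔅 : BDetSet P)
    (h𝔅0 : ∀ b : PBond P 0, b.src ∉ maxDomT M₁ Z 1 → b.tgt ∉ maxDomT M₁ Z 1 → b ∈ 𝔅 0)
    {U : GaugeField P 0 G} (hU : IsMinimizerB av reg 𝔅 (avgFamily av (qsstarGIter0 k W)) U) {δ : ℝ} (hδ : 0 ≤ δ)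
    {𝒞 : Set (PBond P k)} (h𝒞 : ∀ c ∈ 𝒞, dist1 (W c) ≤ δ) {𝒩 : Set (PBond P 0)}
    (hshadow : ∀ b ∈ 𝒩, b.src ∉ maxDomT M₁ Z 1 → b.tgt ∉ maxDomT M₁ Z 1 → B14.Eq22Determines.blockIter k b.tgt ≠ B14.Eq22Determines.blockIter k b.src →
      (⟨B14.Eq22Determines.blockIter k b.src, b.dir⟩ : PBond P k) ∈ 𝒞)
    {b : PBond P 0} (hb𝒩 : b ∈ 𝒩) (hbs : b.src ∉ maxDomT M₁ Z 1) (hbt : b.tgt ∉ maxDomT M₁ Z 1) :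
    dist1 (U b) ≤ δ :=
  dist1_apply_le_of_isMinimizerB_of_not_mem₂ av reg M₁ Z hk W 𝔅 h𝔅0 hU hδ hbs hbt fun h => h𝒞 _ (hshadow b hb𝒩 hbs hbt h)

/-- The set form, DATUM-INTRINSIC: the shadows of the block-crossing scale-`0` members of the datum inside `𝒩` lie in a region `𝒞` on which `W` is `δ`-near `1`.
[cite: Balaban1988Convergent, (2.12)–(2.13) pp.256–257, (2.16) p.257; Balaban1984PropagatorsII, (2.3) p.224] -/
theorem dist1_apply_le_of_isMinimizerB_of_mem_of_shadow (av : ∀ j, Averaging P j G) (reg : Set (GaugeField P 0 G))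
    {k : ℕ} (hk : k ≤ P.m + P.K) (W : GaugeField P k G) (𝔅 : BDetSet P)
    {U : GaugeField P 0 G} (hU : IsMinimizerB av reg 𝔅 (avgFamily av (qsstarGIter0 k W)) U) {δ : ℝ} (hδ : 0 ≤ δ)
    {𝒞 : Set (PBond P k)} (h𝒞 : ∀ c ∈ 𝒞, dist1 (W c) ≤ δ) {𝒩 : Set (PBond P 0)}
    (hshadow : ∀ b ∈ 𝒩, b ∈ 𝔅 0 → B14.Eq22Determines.blockIter k b.tgt ≠ B14.Eq22Determines.blockIter k b.src →
      (⟨B14.Eq22Determines.blockIter k b.src, b.dir⟩ : PBond P k) ∈ 𝒞)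
    {b : PBond P 0} (hb𝒩 : b ∈ 𝒩) (hb : b ∈ 𝔅 0) :
    dist1 (U b) ≤ δ :=
  dist1_apply_le_of_isMinimizerB_of_mem av reg hk W 𝔅 hU hδ hb fun h => h𝒞 _ (hshadow b hb𝒩 hb h)

end Literature.MathematicalPhysics.QuantumFieldTheory.Balaban1983to89.B15Prop1DatumGaugeNormalisationB

end
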